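import Summits.ResolutionOfSingularities.ResolutionOfSingularities.Theorems.PurelyInseparableDim4Equivariance
import Summits.ResolutionOfSingularities.ResolutionOfSingularities.Theorems.PurelyInseparableDim4Line
import HarnessLib

/-!
# [OURS · res-dim4-pi] Renaming-invariance of the secondary invariant is FREE:
  `SecondaryInvariantExistsSym p q ↔ SecondaryInvariantExists p q ↔ Terminates1h p q`

Cell `res-dim4-pi` (D-0157 DOOR 2, wave 2), seat `res-dim4-p-6`; sequel of
`PurelyInseparableDim4Equivariance` (the MODE-1h step relation is S₄-equivariant) and of the landed line file
`PurelyInseparableDim4Line` (TY-1 / PR-6: `SecondaryInvariantExists ↔ Terminates1h`, and `S1i → S1`).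

Desk WORD #9 typed the "shadow of intrinsic-ness": a candidate secondary invariant `Φ` should at least be
invariant under renaming the four base variables (`SecondaryInvariantExistsSym`, the line's support `S1i`).
THIS FILE: at the EXISTENCE level that constraint is vacuous.  If MODE 1h terminates, the quotient of the set of
presented states by the S₄-orbit relation, ordered by «some representatives form a MODE-1h step», is
well-founded — an orbit-chain straightens into a genuine chain because the step relation is equivariant
(`Equivariance.step1h_rename`) — and `s ↦ orbit(s)` is a renaming-invariant secondary invariant.  Hence
`secondaryInvariantExistsSym_iff : SecondaryInvariantExistsSym p q ↔ SecondaryInvariantExists p q`,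
`secondaryInvariantExistsSym_iff_terminates1h`, and in the line's words `Line.S1i_iff_S1 : S1i p ↔ S1 p`
(the converse of the landed `Line.S1_of_S1i`).  So the symmetry requirement only bites on EXPLICIT
candidates (lex words over the letters of WORD #2), never on existence; at `(p, q) = (2, 2)` all three are
refuted anyway (TY-0b `not_terminates1h_two`).

No definition is introduced (the orbit setoid is a term inside the proof).  [OURS · counted 0 · elementary ·
AI kernel work, weaker than expert review.]  NOTHING here is a statement about resolution of singularities;
resolution in dimension `≥ 4` / characteristic `p > 0` is NOT proved by anything in this file.
bears_on: LADDER-RESOLUTION:D157-DOOR2 (res-dim4-pi).  Host item (DR-157-C): `stmt-ResolutionOfSingularities-16155`, helper.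
-/

noncomputable section

set_option linter.dupNamespace false -- mandated namespace of this single-conjunct summit

namespace Summit.ResolutionOfSingularities.ResolutionOfSingularities.Theorems.PIDim4

namespace Equivariance

open MvPolynomial Finset
open Literature.AlgebraicGeometry.Resolution

variable {K : Type} [Field K] [DecidableEq K]

omit [DecidableEq K] in
/-- Renaming twice is renaming by the composite: `(s.rename a).rename b = s.rename (a.trans b)`. [folklore] -/
theorem rename_trans (a b : Equiv.Perm (Fin 4)) (s : State K) :
    (s.rename a).rename b = s.rename (a.trans b) := by
  obtain ⟨F, r, exc⟩ := s
  show (⟨rename b (rename a F), (r.mapDomain a).mapDomain b, (exc.map a.toEmbedding).map b.toEmbedding⟩ :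
      State K) = ⟨rename (a.trans b) F, r.mapDomain (a.trans b), exc.map (a.trans b).toEmbedding⟩
  rw [rename_rename, ← Finsupp.mapDomain_comp, Equiv.coe_trans, Finset.map_map]
  rfl

omit [DecidableEq K] in
/-- Renaming by the identity does nothing. [folklore] -/
theorem rename_refl (s : State K) : s.rename (Equiv.refl (Fin 4)) = s := by
  obtain ⟨F, r, exc⟩ := s
  show (⟨rename (Equiv.refl (Fin 4)) F, r.mapDomain (Equiv.refl (Fin 4)),
      exc.map (Equiv.refl (Fin 4)).toEmbedding⟩ : State K) = ⟨F, r, exc⟩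
  rw [Equiv.coe_refl, Finsupp.mapDomain_id, Equiv.refl_toEmbedding, Finset.map_refl]
  congr 1
  exact DFunLike.congr_fun rename_id F

/-- **Straightening an orbit-chain.**  If `s_k ⟶ s'_k` are MODE-1h steps and each `s_{k+1}` is a renaming
of `s'_k`, then suitable renamings `u_k` of the `s_k` form a genuine infinite MODE-1h chain (cumulative
permutations; uses `Equivariance.step1h_rename`). [folklore] -/
theorem exists_chain_of_orbit_chain {q : ℕ} (s s' : ℕ → State K) (e : ℕ → Equiv.Perm (Fin 4))
    (hstep : ∀ k, Step1h q (s k) (s' k)) (hrel : ∀ k, s (k + 1) = (s' k).rename (e k)) :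
    ∃ u : ℕ → State K, ∀ k, Step1h q (u k) (u (k + 1)) := by
  let g : ℕ → Equiv.Perm (Fin 4) := fun k =>
    Nat.rec (motive := fun _ => Equiv.Perm (Fin 4)) (Equiv.refl _) (fun k gk => (e k).symm.trans gk) k
  have hg : ∀ k, g (k + 1) = (e k).symm.trans (g k) := fun _ => rfl
  refine ⟨fun k => (s k).rename (g k), fun k => ?_⟩
  have h2 : (s' k).rename (g k) = (s (k + 1)).rename (g (k + 1)) := by
    rw [hrel k, rename_trans, hg, ← Equiv.trans_assoc, Equiv.self_trans_symm, Equiv.refl_trans]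
  have h1 := step1h_rename (g k) (hstep k)
  rwa [h2] at h1

/-- **Symmetrisation is free**: termination of MODE 1h yields a RENAMING-INVARIANT secondary invariant —
the S₄-orbit of the state, in the quotient ordered by «some representatives form a MODE-1h step»
(well-founded: an infinite orbit-chain would straighten into an infinite MODE-1h chain). [folklore] -/
theorem secondaryInvariantExistsSym_of_terminates1h (p q : ℕ) (hT : Terminates1h p q) :
    SecondaryInvariantExistsSym p q := by
  intro K _ _ _
  let R : Setoid (State K) :=
    ⟨fun s t => ∃ e : Equiv.Perm (Fin 4), t = s.rename e,
      ⟨fun s => ⟨Equiv.refl _, (rename_refl s).symm⟩,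
        fun {s t} h => by
          obtain ⟨e, h⟩ := h
          exact ⟨e.symm, by rw [h, rename_rename_symm]⟩,
        fun {s t u} h h' => by
          obtain ⟨e, h⟩ := h
          obtain ⟨f, h'⟩ := h'
          exact ⟨e.trans f, by rw [h', h, rename_trans]⟩⟩⟩
  refine ⟨Quotient R,
    fun x y => ∃ s s' : State K, Quotient.mk R s' = x ∧ Quotient.mk R s = y ∧ Step1h q s s',
    ?_, Quotient.mk R, fun s s' h => ⟨s, s', rfl, rfl, h⟩, fun e s => ?_⟩
  · rw [wellFounded_iff_isEmpty_descending_chain]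
    refine ⟨fun ⟨x, hx⟩ => ?_⟩
    choose s s' hs' hs hstep using hx
    have hrel : ∀ k, ∃ e : Equiv.Perm (Fin 4), s (k + 1) = (s' k).rename e := fun k =>
      Quotient.exact ((hs' k).trans (hs (k + 1)).symm)
    choose e he using hrel
    exact hT K (exists_chain_of_orbit_chain s s' e hstep he)
  · exact Quotient.sound ⟨e.symm, (rename_rename_symm e s).symm⟩

/-- **`SecondaryInvariantExistsSym p q ↔ SecondaryInvariantExists p q`** — the renaming-invariance
requirement of WORD #9 costs nothing at the existence level (forward: the landed
`secondaryInvariantExists_of_sym`; backward: via termination, `terminates1h_of_secondaryInvariantExists`).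
[folklore] -/
theorem secondaryInvariantExistsSym_iff (p q : ℕ) :
    SecondaryInvariantExistsSym p q ↔ SecondaryInvariantExists p q :=
  ⟨secondaryInvariantExists_of_sym p q, fun h =>
    secondaryInvariantExistsSym_of_terminates1h p q (terminates1h_of_secondaryInvariantExists p q h)⟩

/-- `SecondaryInvariantExistsSym p q ↔ Terminates1h p q`. [folklore] -/
theorem secondaryInvariantExistsSym_iff_terminates1h (p q : ℕ) :
    SecondaryInvariantExistsSym p q ↔ Terminates1h p q :=
  (secondaryInvariantExistsSym_iff p q).trans (secondaryInvariantExists_iff_terminates1h p q)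

end Equivariance

namespace Line

/-- **`S1i p ↔ S1 p`** (the line's support S1i is equivalent to its crux S1; converse of `S1_of_S1i`).
[OURS · CANDIDATE FRAME] [folklore] -/
theorem S1i_iff_S1 (p : ℕ) : S1i p ↔ S1 p :=
  Equivariance.secondaryInvariantExistsSym_iff p p

/-- `S1i p ↔ Terminates1h p p`. [OURS · CANDIDATE FRAME] [folklore] -/
theorem S1i_iff_terminates (p : ℕ) : S1i p ↔ Terminates1h p p :=
  Equivariance.secondaryInvariantExistsSym_iff_terminates1h p p

end Line

end Summit.ResolutionOfSingularities.ResolutionOfSingularities.Theorems.PIDim4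

end
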